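/-
Copyright: b2b-lace packet (literature seat, gen 15).  [FvdH17] §4.4, the paragraph after (4.65), and the
caption of Fig. 12 (§6.1): the CODING step that makes the level-`i` lines `{b̄_{i−1} ↔ t_i} ∘ {t_i ↔ z_i}` avoid the
previous cluster `C̃_{i−1}` except at `t_i` / `z_i` — the deterministic input of the repulsive (cross-level) bound
(6.4).  LEMMAS §25 leaf N76-X1-j, parts (i)+(ii).  No named fact; no numeral; no dimension.
-/
import Literature.Probability.FitznerVanDerHofstad2017.NobleBoundingEvents
import HarnessLib

/-!
# [FvdH17] §4.4 / §6.1 — the last sausage is reached OFF `C̃_{i−1}`: an `A`-avoiding version of (4.63)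

CITATION HEADER (PLACEMENT v2). This module is part of a certified REPRODUCTION of:
R. Fitzner, R. van der Hofstad, *Mean-field behavior for nearest-neighbor percolation in d > 10*,
Electron. J. Probab. 22 (2017), no. 43 [FvdH17], §4.4 (arXiv:1506.07977v2 pp. 41–43 = EJP pp. 38–41) and §6.1
(v2 pp. 57–59 = EJP pp. 52–54).  Origin: build `lace` (host summit CriticalPhenomena), literature seat.

THE PRINTED SENTENCES (v2 p. 43, TeX l.9113–9118): "For our bounds, we use one additional property of the diagram
… In most cases, we can choose `z_i` such that there exists a path from `w_{i−1}` to `z_i` in `C̃_{i−1}` that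
intersects `C̃_i` only at its endpoint `z_i`.  We can bound such events using repulsive diagrams. … In this case,
all paths involved in the above connections are bond disjoint, even when they occur in different levels."  Fig. 12
(v2 p. 58): "we choose `z` such that the connection `{w ↔ z}` intersects with `C̃₁` only at `z`, so that all
connections are bond-disjoint."

WHAT IS PROVED (the precise version recorded in HOME/GAPS "Literature seat gen 15" (2) and LEMMAS §25 add.
lit-g15; a READING of the printed sentence — the print's one-line recipe "`z_i` closest to `b̄_{i−1}`" is replaced
by a choice that is compatible with the last-sausage structure of `F_N`):

* `LaceGraph.exists_first_edge` — a walk splits at its FIRST edge with a given property.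
* **`exists_offA_theta_of_mem_laceE`** — on a configuration using only bonds of `ℤ^d`, if `E'(v, x; A)` occurs
  (tree: `laceE A v x` = `{v ↔ x through A}` ∩ {no pivotal bond `(u',v')` for `v → x` with `v ↔ u'` through `A`}),
  then there are `z ∈ A`, `t`, and four pairwise EDGE-DISJOINT open walks `W₁ : v → t`, `W₂ : t → z`,
  `W₃ : t → x`, `W₄ : z → x` (the four lines of `F_N((u,v),t,z,x)`, (4.58)) such that **`W₁` has no vertex in
  `A` other than `t` and `W₂` has no vertex in `A` other than `z`**.  Construction: `t` = the far endpoint of the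
  LAST bond of an open `v–x` path whose removal separates `v` from `x` (a pivotal bond, by
  `isPivotalBond_of_not_reachable`); the `E'` clause gives an open `v–b̲` path inside `Aᶜ` (`W₁` = that path's
  bypass followed by the pivotal bond); no later bond separates, so Menger (`exists_two_edgeDisjoint_paths`) gives
  two edge-disjoint `t–x` routes `P, Q`; `z` = the first `A`-vertex on `P` (`{v ↔ x through A}` forces one);
  `W₂, W₄` = the two pieces of `P`, `W₃ = Q`; the bridge argument (`v`'s side / `x`'s side of the pivotal bond)
  gives the disjointness of `W₁` from `P, Q`.  If no bond separates, `t = v` and `W₁` is trivial.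
* `eventFNoff A u v t z x` — the witness form of `F_N` with the OFF-`A` clause "every bond of the witnesses of
  `{v ↔ t}` and `{t ↔ z}` has an endpoint outside `A`", and **`exists_mem_eventFNoff_of_mem_laceE`** — (4.63) with
  this refinement (`E_vac(u)` supplies `u ∉ {t, z, x}` as in `exists_mem_eventFN_of_mem_laceE`); `eventFNoff ⊆ eventFN`.
* `probOff_laceE_le_tsum_eventFNoff`, **`nobleKerXi_le_tsum_eventFNoff`** — (4.63) with the off-`A` clause under
  `P^{b̲_{N-1}}` and for the innermost NoBLE kernel (verbatim the proofs of `probOff_laceE_le_tsum_eventFN` /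
  `nobleKerXi_le_tsum_eventFN` with the refined event): the input for a JOINT two-level form of (4.65).

WHY (HOME/DIVERGENCE D71, GAPS lit-g15): a level-`(i−1)` witness is an open path inside `C̃_{i−1} = A`, all of whose
bonds join two vertices of `A`; a bond with an endpoint outside `A` is therefore never shared with it.  This is the
cross-level bond-disjointness that the repulsive letters `𝓣_{1̲,1,1}`, `𝓣_{1̲,1,0}`, `𝓣_{1,1̲,0}` of §6.1 (cases
`b = 0` / `a = 0`) consume, and that the product display (4.65) cannot remember.

## References
* [FvdH17] R. Fitzner, R. van der Hofstad, EJP 22 (2017) no. 43; arXiv:1506.07977v2 — Def. 3.2 ('through', v2 p. 21),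
  (3.17) `E'` (v2 p. 22), §4.4 (4.58), (4.63), (4.65) and the paragraph after it (v2 pp. 41–43), §6.1 Fig. 12 (v2 p. 58).
* [HvdH17] M. Heydenreich, R. van der Hofstad, Progress in high-dimensional percolation and random graphs, Springer
  2017 — (7.2.21) (the last sausage), Def. 6.2–6.3.
* [Die17] R. Diestel, Graph Theory, 5th ed. — Thm. 3.3.1 (Menger, edge version, `k = 2`).
-/

namespace Literature.Barriers.CriticalPhenomena

namespace LaceGraph

open _root_.SimpleGraph

variable {V : Type*} {G : _root_.SimpleGraph V}

/-- **First edge with a property.** If some edge of a walk satisfies `P`, the walk splits as `q₁ ++ (a → b) :: q₂`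
at the FIRST such edge: `P s(a,b)` and no edge of `q₁` satisfies `P`. [folklore] -/
theorem exists_first_edge (P : Sym2 V → Prop) :
    ∀ {u v : V} (p : G.Walk u v), (∃ e ∈ p.edges, P e) →
      ∃ (a b : V) (q₁ : G.Walk u a) (h : G.Adj a b) (q₂ : G.Walk b v),
        p = q₁.append (Walk.cons h q₂) ∧ P s(a, b) ∧ ∀ e ∈ q₁.edges, ¬ P e
  | u, _, Walk.nil, h => by
    obtain ⟨e, he, -⟩ := h
    simp at he
  | u, v, Walk.cons (v := w) hadj p, h => by
    classical
    by_cases huw : P s(u, w)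
    · exact ⟨u, w, Walk.nil, hadj, p, rfl, huw, fun e he => by simp at he⟩
    · have h' : ∃ e ∈ p.edges, P e := by
        obtain ⟨e, he, hPe⟩ := h
        rw [Walk.edges_cons, List.mem_cons] at he
        rcases he with rfl | he
        · exact absurd hPe huw
        · exact ⟨e, he, hPe⟩
      obtain ⟨a, b, q₁, hab, q₂, hp, hP, hmin⟩ := exists_first_edge P p h'
      refine ⟨a, b, Walk.cons hadj q₁, hab, q₂, by rw [hp]; rfl, hP, fun e he => ?_⟩
      rw [Walk.edges_cons, List.mem_cons] at he
      rcases he with rfl | he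
      · exact huw
      · exact hmin e he

/-- Every vertex of a walk avoiding the edge `e` is joined to the start by a walk avoiding `e`. [folklore] -/
theorem exists_walk_avoiding_of_mem_support [DecidableEq V] {u v : V} (p : G.Walk u v) {e : Sym2 V}
    (he : e ∉ p.edges) {c : V} (hc : c ∈ p.support) :
    (∃ q : G.Walk u c, e ∉ q.edges) ∧ ∃ q : G.Walk c v, e ∉ q.edges :=
  ⟨⟨p.takeUntil c hc, fun h => he (p.edges_takeUntil_subset_edges hc h)⟩,
    ⟨p.dropUntil c hc, fun h => he (p.edges_dropUntil_subset_edges hc h)⟩⟩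

end LaceGraph

end Literature.Barriers.CriticalPhenomena

/-! ### The off-`A` coding of the last sausage -/

namespace Literature.Probability.FitznerVanDerHofstad2017

section OffA

open _root_.MeasureTheory Literature.Barriers.CriticalPhenomena Literature.Probability.Percolation
open Literature.Probability.LatticeModels
open _root_.SimpleGraph Literature.Combinatorics.SimpleGraph

variable {d : ℕ}

/-- An open walk avoiding the bond `e` joins each of its vertices to both ends avoiding `e`. [folklore] -/
theorem reachable_sdiff_of_mem_support {ω : BondConfig (Site d)} {u v : Site d} (q : (openGraph ω).Walk u v)
    {e : Sym2 (Site d)} (he : e ∉ q.edges) {c : Site d} (hc : c ∈ q.support) :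
    (openGraph (ω \ {e})).Reachable u c ∧ (openGraph (ω \ {e})).Reachable c v := by
  classical
  obtain ⟨⟨q₁, h₁⟩, ⟨q₂, h₂⟩⟩ := LaceGraph.exists_walk_avoiding_of_mem_support q he hc
  exact ⟨reachable_sdiff_of_walk q₁ h₁, reachable_sdiff_of_walk q₂ h₂⟩

/-- **The last sausage is reached off `A`** ([FvdH17] §4.4, paragraph after (4.65); Fig. 12): see the module
docstring.  For a configuration using only bonds of `ℤ^d` and `ω ∈ E'(v, x; A)`: there are `z ∈ A`, `t` and four
pairwise edge-disjoint open walks `v → t → z`, `t → x`, `z → x` with `W₁ ∩ A ⊆ {t}` and `W₂ ∩ A ⊆ {z}` (as vertex sets).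
[cite: FitznerVanDerHofstad2017, §4.4 paragraph after (4.65) and (4.63) (arXiv:1506.07977v2 pp. 42–43; EJP 22 (2017) no. 43 pp. 39–41); §6.1 Fig. 12 caption (v2 p. 58)]
[cite: HeydenreichVanDerHofstad2017, (7.2.21)] -/
theorem exists_offA_theta_of_mem_laceE {ω : BondConfig (Site d)} (hω : ω ⊆ (zdGraph d).edgeSet)
    {A : Set (Site d)} {v x : Site d} (hE : ω ∈ laceE A v x) :
    ∃ z ∈ A, ∃ (t : Site d) (W₁ : (openGraph ω).Walk v t) (W₂ : (openGraph ω).Walk t z)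
      (W₃ : (openGraph ω).Walk t x) (W₄ : (openGraph ω).Walk z x),
      List.Disjoint W₁.edges W₂.edges ∧ List.Disjoint W₁.edges W₃.edges ∧ List.Disjoint W₁.edges W₄.edges ∧
      List.Disjoint W₂.edges W₃.edges ∧ List.Disjoint W₂.edges W₄.edges ∧ List.Disjoint W₃.edges W₄.edges ∧
      (∀ y ∈ W₁.support, y ∈ A → y = t) ∧ (∀ y ∈ W₂.support, y ∈ A → y = z) := by
  classical
  obtain ⟨⟨hvx, hnot⟩, hpiv⟩ := (mem_laceE_iff A v x ω).1 hE
  -- every open `v–x` walk meets `A`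
  have hmeet : ∀ W : (openGraph ω).Walk v x, ∃ y ∈ W.support, y ∈ A := by
    intro W
    by_contra hcon
    push Not at hcon
    exact hnot (openConnIn_of_walk W fun y hy => hcon y hy)
  obtain ⟨p, hp⟩ := (show (openGraph ω).Reachable v x from hvx).exists_isPath
  -- STEP 1: the first piece `W₁ : v → t` inside `Aᶜ ∪ {t}` and two edge-disjoint `t–x` routes avoiding it.
  have key : ∃ (t : Site d) (W₁ : (openGraph ω).Walk v t) (P Q : (openGraph ω).Walk t x),
      P.IsPath ∧ Q.IsPath ∧ List.Disjoint P.edges Q.edges ∧ List.Disjoint W₁.edges P.edges ∧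
        List.Disjoint W₁.edges Q.edges ∧ (∀ y ∈ W₁.support, y ∈ A → y = t) := by
    by_cases hcut : ∃ e ∈ p.reverse.edges, ¬ (openGraph (ω \ {e})).Reachable v x
    · -- the LAST separating bond of `p` = the FIRST one of `p.reverse`
      obtain ⟨a, b, r₁, hab, r₂, hpr, hsep, hmin⟩ :=
        LaceGraph.exists_first_edge (fun e => ¬ (openGraph (ω \ {e})).Reachable v x) p.reverse hcut
      -- notation: `t := a` (far endpoint), bottom `b`; `q₁ : v → b`, `q₂ : a → x`
      have hba : (openGraph ω).Adj b a := hab.symm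
      let q₁ : (openGraph ω).Walk v b := r₂.reverse
      let q₂ : (openGraph ω).Walk a x := r₁.reverse
      have hpeq : p = q₁.append (Walk.cons hba q₂) := by
        have h := congrArg Walk.reverse hpr
        rw [Walk.reverse_reverse] at h
        rw [h, Walk.reverse_append, Walk.reverse_cons, ← Walk.append_assoc, Walk.cons_append, Walk.nil_append]
      have hpath : (q₁.append (Walk.cons hba q₂)).IsPath := hpeq ▸ hp
      have hsep' : ¬ (openGraph (ω \ {s(b, a)})).Reachable v x := by rw [Sym2.eq_swap]; exact hsep
      -- edges of `q₁`, `q₂` avoid the bridge `β = s(b,a)`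
      have hnd := hpath.isTrail.edges_nodup
      rw [Walk.edges_append, Walk.edges_cons] at hnd
      have hβq₁ : s(b, a) ∉ q₁.edges := fun h => (List.disjoint_of_nodup_append hnd) h List.mem_cons_self
      have hβq₂ : s(b, a) ∉ q₂.edges := (List.nodup_cons.1 hnd.of_append_right).1
      -- `x`'s side: every vertex of `q₂` reaches `x` avoiding `β`
      have hq₂x : ∀ c ∈ q₂.support, (openGraph (ω \ {s(b, a)})).Reachable c x :=
        fun c hc => (reachable_sdiff_of_mem_support q₂ hβq₂ hc).2
      -- the pivotal bond `(b, a)` and the `E'` clause: an open `v–b` path inside `Aᶜ`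
      have hP : IsPivotalBond ω v x b a := isPivotalBond_of_not_reachable hω q₁ hba q₂ hpath hsep'
      have hvb : ω ∉ connThrough A v b := hpiv b a hP
      rw [mem_connThrough_iff, not_and, not_not] at hvb
      obtain ⟨s₁, hs₁⟩ := exists_walk_of_openConnIn (hvb ⟨q₁⟩)
      set γ : (openGraph ω).Walk v b := s₁.bypass with hγ
      have hγA : ∀ y ∈ γ.support, y ∉ A := fun y hy => hs₁ y (s₁.support_bypass_subset_support hy)
      have hγpath : γ.IsPath := s₁.bypass_isPath
      -- `γ` avoids the bridge
      have hβγ : s(b, a) ∉ γ.edges := by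
        intro hmem
        obtain ⟨c, c', g₁, hcc', g₂, he, hg⟩ := LaceGraph.exists_append_cons_of_mem_edges γ hmem
        have hndγ := hγpath.isTrail.edges_nodup
        rw [hg, Walk.edges_append, Walk.edges_cons] at hndγ
        have h1 : s(c, c') ∉ g₁.edges := fun h => (List.disjoint_of_nodup_append hndγ) h List.mem_cons_self
        have h2 : s(c, c') ∉ g₂.edges := (List.nodup_cons.1 hndγ.of_append_right).1
        rw [← he] at h1 h2
        rcases Sym2.eq_iff.1 he with ⟨rfl, rfl⟩ | ⟨rfl, rfl⟩
        · -- `c = b`, `c' = a`: `v ~ b` by `g₁`, then `g₂ : a → b` reversed gives `b ~ a`, and `a ~ x`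
          exact hsep' (((reachable_sdiff_of_walk g₁ h1).trans (reachable_sdiff_of_walk g₂ h2).symm).trans
            (hq₂x _ q₂.start_mem_support))
        · -- `c = a`, `c' = b`: `v ~ a` by `g₁`, and `a ~ x`
          exact hsep' ((reachable_sdiff_of_walk g₁ h1).trans (hq₂x _ q₂.start_mem_support))
      -- `v`'s side: every vertex of `γ` is reached from `v` avoiding `β`
      have hγv : ∀ c ∈ γ.support, (openGraph (ω \ {s(b, a)})).Reachable v c :=
        fun c hc => (reachable_sdiff_of_mem_support γ hβγ hc).1
      -- `W₁ := γ` followed by the bridge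
      set W₁ : (openGraph ω).Walk v a := γ.concat hba with hW₁
      have hW₁edges : W₁.edges = γ.edges ++ [s(b, a)] := by
        rw [hW₁, Walk.edges_concat, List.concat_eq_append]
      have hW₁A : ∀ y ∈ W₁.support, y ∈ A → y = a := by
        intro y hy hyA
        rw [hW₁, Walk.support_concat, List.mem_append, List.mem_singleton] at hy
        rcases hy with hy | rfl
        · exact absurd hyA (hγA y hy)
        · rfl
      -- any `a–x` PATH avoids the bridge and is edge-disjoint from `W₁`
      have hroute : ∀ R : (openGraph ω).Walk a x, R.IsPath →
          s(b, a) ∉ R.edges ∧ List.Disjoint W₁.edges R.edges := by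
        intro R hR
        have hβR : s(b, a) ∉ R.edges := by
          intro hmem
          obtain ⟨c, c', R₁, hcc', R₂, he, hRe⟩ := LaceGraph.exists_append_cons_of_mem_edges R hmem
          have hndR := hR.isTrail.edges_nodup
          rw [hRe, Walk.edges_append, Walk.edges_cons] at hndR
          have h1 : s(c, c') ∉ R₁.edges := fun h => (List.disjoint_of_nodup_append hndR) h List.mem_cons_self
          have h2 : s(c, c') ∉ R₂.edges := (List.nodup_cons.1 hndR.of_append_right).1
          rw [← he] at h1 h2
          rcases Sym2.eq_iff.1 he with ⟨rfl, rfl⟩ | ⟨rfl, rfl⟩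
          · -- `c = b`, `c' = a`: `R₁ : a → b` avoiding `β`, so `v ~ b ~ a ~ x`
            exact hsep' (((reachable_sdiff_of_walk γ hβγ).trans (reachable_sdiff_of_walk R₁ h1).symm).trans
              (hq₂x _ q₂.start_mem_support))
          · -- `c = a`, `c' = b`: `R₂ : b → x` avoiding `β`, so `v ~ b ~ x`
            exact hsep' ((reachable_sdiff_of_walk γ hβγ).trans (reachable_sdiff_of_walk R₂ h2))
        refine ⟨hβR, ?_⟩
        intro e heW heR
        rw [hW₁edges, List.mem_append, List.mem_singleton] at heW
        rcases heW with heγ | rfl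
        · -- an edge of `γ` (both endpoints on `v`'s side) cannot be an edge of `R` (on `x`'s side)
          revert heR heγ
          refine Sym2.ind (fun c c' h2 h1 => ?_) e
          have hcv : (openGraph (ω \ {s(b, a)})).Reachable v c := hγv c (γ.fst_mem_support_of_mem_edges h1)
          have hcx : (openGraph (ω \ {s(b, a)})).Reachable c x :=
            (reachable_sdiff_of_mem_support R hβR (R.fst_mem_support_of_mem_edges h2)).2
          exact hsep' (hcv.trans hcx)
        · exact hβR heR
      -- two edge-disjoint `a–x` routes (Menger, `k = 2`): no edge of `r₁ : x → a` separates
      have hr₁path : r₁.IsPath := by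
        have h' : (r₁.append (Walk.cons hab r₂)).IsPath := hpr ▸ hp.reverse
        exact (LaceGraph.isPath_of_append h').1
      obtain ⟨P, Q, hPp, hQp, hPQ⟩ := LaceGraph.exists_two_edgeDisjoint_paths r₁ hr₁path fun e he => by
        have hex : (openGraph (ω \ {e})).Reachable v x := by
          by_contra h
          exact hmin e he h
        -- `e` is not an edge of `W₁`
        have heW : e ∉ W₁.edges := by
          intro heW
          rw [hW₁edges, List.mem_append, List.mem_singleton] at heW
          have he' : e ∈ q₂.edges := by
            show e ∈ r₁.reverse.edges
            rw [Walk.edges_reverse, List.mem_reverse]; exact he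
          rcases heW with heγ | rfl
          · revert he' heγ
            refine Sym2.ind (fun c c' h2 h1 => ?_) e
            exact hsep' ((hγv c (γ.fst_mem_support_of_mem_edges h1)).trans
              (hq₂x c (q₂.fst_mem_support_of_mem_edges h2)))
          · exact hβq₂ he'
        exact exists_walk_of_reachable_sdiff ((reachable_sdiff_of_walk W₁ heW).symm.trans hex)
      exact ⟨a, W₁, P, Q, hPp, hQp, hPQ, (hroute P hPp).2, (hroute Q hQp).2, hW₁A⟩
    · -- no separating bond: `t = v`, `W₁` trivial
      push Not at hcut
      obtain ⟨P, Q, hPp, hQp, hPQ⟩ := LaceGraph.exists_two_edgeDisjoint_paths p.reverse hp.reverse fun e he =>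
        exists_walk_of_reachable_sdiff (hcut e he)
      refine ⟨v, Walk.nil, P, Q, hPp, hQp, hPQ, by simp, by simp, fun y hy _ => ?_⟩
      simpa using hy
  -- STEP 2: split the first route at its first `A`-vertex.
  obtain ⟨t, W₁, P, Q, hPp, hQp, hPQ, hW1P, hW1Q, hW₁A⟩ := key
  have hPA : ∃ y ∈ P.support, y ∈ A := by
    obtain ⟨y, hy, hyA⟩ := hmeet (W₁.append P)
    rw [Walk.mem_support_append_iff] at hy
    rcases hy with hy | hy
    · exact ⟨t, P.start_mem_support, hW₁A y hy hyA ▸ hyA⟩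
    · exact ⟨y, hy, hyA⟩
  obtain ⟨z, P₁, P₂, hP12, hzA, hfirst⟩ := exists_append_first_mem A P hPA
  rw [hP12] at hPp hPQ hW1P
  have hndP := hPp.isTrail.edges_nodup
  rw [Walk.edges_append] at hndP hPQ hW1P
  refine ⟨z, hzA, t, W₁, P₁, Q, P₂, (List.disjoint_append_right.1 hW1P).1, hW1Q,
    (List.disjoint_append_right.1 hW1P).2, (List.disjoint_append_left.1 hPQ).1,
    List.disjoint_of_nodup_append hndP, ((List.disjoint_append_left.1 hPQ).2).symm, hW₁A, hfirst⟩

/-! ### The refined bounding event `F_N^{off}` and (4.63) with the off-`A` clause -/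

/-- **`F_N^{off}(b_{N−1}, t, z, x; A)`** — the four lines of `F_N` ((4.58)) in WITNESS form (pairwise disjoint open
bond sets `K₁ ∈ {v ↔ t}`, `K₂ ∈ {t ↔ z}`, `K₃ ∈ {t ↔ x}`, `K₄ ∈ {z ↔ x}`) with `b̲_{N−1} = u ∉ {t, z, x}` AND the
off-`A` clause: every bond of `K₁ ∪ K₂` has an endpoint outside `A`.
[cite: FitznerVanDerHofstad2017, (4.58) and the paragraph after (4.65) (arXiv:1506.07977v2 pp. 41, 43)] -/
def eventFNoff (A : Set (Site d)) (u v t z x : Site d) : Set (BondConfig (Site d)) :=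
  {ω | ∃ K₁ K₂ K₃ K₄ : Set (Sym2 (Site d)),
      K₁ ⊆ ω ∧ K₂ ⊆ ω ∧ K₃ ⊆ ω ∧ K₄ ⊆ ω ∧
      K₁ ∈ (openConn v t : Set (BondConfig (Site d))) ∧ K₂ ∈ (openConn t z : Set (BondConfig (Site d))) ∧
      K₃ ∈ (openConn t x : Set (BondConfig (Site d))) ∧ K₄ ∈ (openConn z x : Set (BondConfig (Site d))) ∧
      Disjoint K₁ K₂ ∧ Disjoint K₁ K₃ ∧ Disjoint K₁ K₄ ∧ Disjoint K₂ K₃ ∧ Disjoint K₂ K₄ ∧ Disjoint K₃ K₄ ∧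
      (∀ e ∈ K₁ ∪ K₂, ∃ a ∈ e, a ∉ A)} ∩
    {_ω | u ∉ ({t, z, x} : Set (Site d))}

/-- The edge set of an open walk, as a set of bonds, lies in the configuration. [folklore] -/
theorem edgesSet_subset_of_walk {V : Type*} {ω : BondConfig V} {a b : V} (W : (openGraph ω).Walk a b) :
    {e | e ∈ W.edges} ⊆ ω := fun _ he => mem_of_mem_walk_edges W he

/-- The edge set of an open walk witnesses the connection of its endpoints. [folklore] -/
theorem edgesSet_mem_openConn {V : Type*} {ω : BondConfig V} {a b : V} (W : (openGraph ω).Walk a b) :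
    ({e | e ∈ W.edges} : Set (Sym2 V)) ∈ (openConn a b : Set (BondConfig V)) :=
  reachable_openGraph_of_walk W fun _ he => he

/-- Edge-disjoint walks have disjoint edge sets. [folklore] -/
theorem disjoint_edgesSet_of_disjoint {V : Type*} {ω : BondConfig V} {a₁ b₁ a₂ b₂ : V}
    (W : (openGraph ω).Walk a₁ b₁) (W' : (openGraph ω).Walk a₂ b₂) (h : List.Disjoint W.edges W'.edges) :
    Disjoint ({e | e ∈ W.edges} : Set (Sym2 V)) {e | e ∈ W'.edges} :=
  Set.disjoint_left.2 fun _ he he' => h he he'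

/-- A walk whose only `A`-vertex can be its endpoint `t` has, on every edge, an endpoint outside `A`. [folklore] -/
theorem exists_not_mem_of_mem_edges {V : Type*} {G : _root_.SimpleGraph V} {A : Set V} {a t : V}
    (W : G.Walk a t) (hW : ∀ y ∈ W.support, y ∈ A → y = t) {e : Sym2 V} (he : e ∈ W.edges) :
    ∃ c ∈ e, c ∉ A := by
  revert he
  refine Sym2.ind (fun c c' h => ?_) e
  by_cases hc : c ∈ A
  · have hct : c = t := hW c (W.fst_mem_support_of_mem_edges h) hc
    refine ⟨c', Sym2.mem_mk_right _ _, fun hc' => ?_⟩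
    have hc't : c' = t := hW c' (W.snd_mem_support_of_mem_edges h) hc'
    exact (W.adj_of_mem_edges h).ne (hct.trans hc't.symm)
  · exact ⟨c, Sym2.mem_mk_left _ _, hc⟩

/-- `F_N^{off}` is increasing in the configuration (for fixed `A`). [folklore] -/
theorem isUpperSet_eventFNoff (A : Set (Site d)) (u v t z x : Site d) : IsUpperSet (eventFNoff A u v t z x) := by
  rintro ω ω' hle ⟨⟨K₁, K₂, K₃, K₄, h₁, h₂, h₃, h₄, hrest⟩, hu⟩
  exact ⟨⟨K₁, K₂, K₃, K₄, h₁.trans hle, h₂.trans hle, h₃.trans hle, h₄.trans hle, hrest⟩, hu⟩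

/-- `F_N^{off} ⊆ F_N` (forget the off-`A` clause). [cite: FitznerVanDerHofstad2017, (4.58) (arXiv:1506.07977v2 p. 41)] -/
theorem eventFNoff_subset_eventFN (A : Set (Site d)) (u v t z x : Site d) :
    eventFNoff A u v t z x ⊆ eventFN u v t z x := by
  rintro ω ⟨⟨K₁, K₂, K₃, K₄, h₁, h₂, h₃, h₄, hK₁, hK₂, hK₃, hK₄, d₁₂, d₁₃, d₁₄, d₂₃, d₂₄, d₃₄, -⟩, hu⟩
  refine ⟨?_, hu⟩
  refine mem_disjointOccurrenceList_of_pairwise_disjoint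
    [(openConn v t, K₁), (openConn t z, K₂), (openConn t x, K₃), ((openConn z x : Set (BondConfig (Site d))), K₄)]
    ?_ ?_ ?_ ?_
  · intro q hq
    simp only [List.mem_cons, List.not_mem_nil, or_false] at hq
    rcases hq with rfl | rfl | rfl | rfl <;> exact isUpperSet_openConn _ _
  · intro q hq
    simp only [List.mem_cons, List.not_mem_nil, or_false] at hq
    rcases hq with rfl | rfl | rfl | rfl
    · exact hK₁
    · exact hK₂
    · exact hK₃
    · exact hK₄
  · simp only [List.pairwise_cons, List.mem_cons, List.not_mem_nil, or_false, forall_eq_or_imp, forall_eq,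
      List.Pairwise.nil, and_true]
    exact ⟨⟨d₁₂, d₁₃, d₁₄⟩, ⟨d₂₃, d₂₄⟩, d₃₄, fun _ h => h.elim⟩
  · intro q hq
    simp only [List.mem_cons, List.not_mem_nil, or_false] at hq
    rcases hq with rfl | rfl | rfl | rfl
    · exact h₁
    · exact h₂
    · exact h₃
    · exact h₄

/-- **(4.63) with the off-`A` clause, pointwise**: on a configuration using only bonds of `ℤ^d`, if `E'(v, x; A)`
occurs and every bond at `u ≠ v` is vacant, then `F_N^{off}((u,v), t, z, x; A)` occurs for some `z ∈ A` and some `t`.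
[cite: FitznerVanDerHofstad2017, (4.63) and the paragraph after (4.65) (arXiv:1506.07977v2 pp. 42–43; EJP 22 (2017) no. 43 pp. 39–41)] -/
theorem exists_mem_eventFNoff_of_mem_laceE {ω : BondConfig (Site d)} (hω : ω ⊆ (zdGraph d).edgeSet)
    {A : Set (Site d)} {u v x : Site d} (huv : u ≠ v) (hE : ω ∈ laceE A v x) (hvac : ω ∈ eventVac u) :
    ∃ z ∈ A, ∃ t : Site d, ω ∈ eventFNoff A u v t z x := by
  obtain ⟨z, hzA, t, W₁, W₂, W₃, W₄, h12, h13, h14, h23, h24, h34, hW₁A, hW₂A⟩ :=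
    exists_offA_theta_of_mem_laceE hω hE
  have hvt : ω ∈ (openConn v t : Set (BondConfig (Site d))) := W₁.reachable
  have htz : ω ∈ (openConn t z : Set (BondConfig (Site d))) := W₂.reachable
  have htx : ω ∈ (openConn t x : Set (BondConfig (Site d))) := W₃.reachable
  have htu : t ≠ u := by
    rintro rfl
    exact huv (eq_of_mem_eventVac_of_mem_openConn hvac hvt).symm
  have hzu : z ≠ u := by
    rintro rfl
    exact htu (eq_of_mem_eventVac_of_mem_openConn hvac htz)
  have hxu : x ≠ u := by
    rintro rfl
    exact htu (eq_of_mem_eventVac_of_mem_openConn hvac htx)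
  refine ⟨z, hzA, t, ⟨{e | e ∈ W₁.edges}, {e | e ∈ W₂.edges}, {e | e ∈ W₃.edges}, {e | e ∈ W₄.edges},
    edgesSet_subset_of_walk W₁, edgesSet_subset_of_walk W₂, edgesSet_subset_of_walk W₃, edgesSet_subset_of_walk W₄,
    edgesSet_mem_openConn W₁, edgesSet_mem_openConn W₂, edgesSet_mem_openConn W₃, edgesSet_mem_openConn W₄,
    disjoint_edgesSet_of_disjoint W₁ W₂ h12, disjoint_edgesSet_of_disjoint W₁ W₃ h13,
    disjoint_edgesSet_of_disjoint W₁ W₄ h14, disjoint_edgesSet_of_disjoint W₂ W₃ h23,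
    disjoint_edgesSet_of_disjoint W₂ W₄ h24, disjoint_edgesSet_of_disjoint W₃ W₄ h34, ?_⟩, ?_⟩
  · rintro e (he | he)
    · exact exists_not_mem_of_mem_edges W₁ hW₁A he
    · exact exists_not_mem_of_mem_edges W₂ hW₂A he
  · simp only [Set.mem_setOf_eq, Set.mem_insert_iff, Set.mem_singleton_iff, not_or]
    exact ⟨htu.symm, hzu.symm, hxu.symm⟩

/-! ### (4.63) with the off-`A` clause under `P^{b̲_{N-1}}`, and for the innermost NoBLE kernel -/

/-- **(4.63) with the off-`A` clause, under `P^{b̲_{N-1}}`**: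
`P^{u}(E'(v, x; A)) ≤ Σ_z 𝟙{z ∈ A} Σ_t P^{u}(F_N^{off}((u,v),t,z,x;A))` for `u ≠ v` (union bound over `t, z`; the
non-lattice configurations are a null set) — verbatim the proof of `probOff_laceE_le_tsum_eventFN` with the
refined event.
[cite: FitznerVanDerHofstad2017, (4.63) and the paragraph after (4.65) (arXiv:1506.07977v2 pp. 42–43; EJP 22 (2017) no. 43 pp. 39–41)] -/
theorem probOff_laceE_le_tsum_eventFNoff (p : unitInterval) {A : Set (Site d)} {u v x : Site d} (huv : u ≠ v) :
    probOff d p (bondsAt {u}) (laceE A v x) ≤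
      ∑' z : Site d, ∑' t : Site d, A.indicator (fun z => probOff d p (bondsAt {u}) (eventFNoff A u v t z x)) z := by
  classical
  set B : Set (Sym2 (Site d)) := bondsAt {u} with hB
  set S : Site d → Site d → Set (BondConfig (Site d)) :=
    fun z t => if z ∈ A then occursOff B (eventFNoff A u v t z x) else ∅ with hS
  have hsub : occursOff B (laceE A v x) ⊆ (⋃ z, ⋃ t, S z t) ∪ {ω | ¬ ω ⊆ (zdGraph d).edgeSet} := by
    intro ω hω
    by_cases hl : ω ⊆ (zdGraph d).edgeSet
    · left
      obtain ⟨z, hzA, t, ht⟩ := exists_mem_eventFNoff_of_mem_laceE ((offBonds_subset B ω).trans hl) huv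
        ((mem_occursOff_iff B _ ω).1 hω) (offBonds_bondsAt_singleton_mem_eventVac u ω)
      refine Set.mem_iUnion.2 ⟨z, Set.mem_iUnion.2 ⟨t, ?_⟩⟩
      simp only [hS, if_pos hzA]
      exact ht
    · exact Or.inr hl
  calc probOff d p B (laceE A v x)
      = bondPercolation (zdGraph d) p (occursOff B (laceE A v x)) := rfl
    _ ≤ bondPercolation (zdGraph d) p ((⋃ z, ⋃ t, S z t) ∪ {ω | ¬ ω ⊆ (zdGraph d).edgeSet}) := measure_mono hsub
    _ ≤ bondPercolation (zdGraph d) p (⋃ z, ⋃ t, S z t) +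
          bondPercolation (zdGraph d) p {ω | ¬ ω ⊆ (zdGraph d).edgeSet} := measure_union_le _ _
    _ = bondPercolation (zdGraph d) p (⋃ z, ⋃ t, S z t) := by rw [measure_not_subset_edgeSet, add_zero]
    _ ≤ ∑' z, bondPercolation (zdGraph d) p (⋃ t, S z t) := measure_iUnion_le _
    _ ≤ ∑' z, ∑' t, bondPercolation (zdGraph d) p (S z t) :=
          ENNReal.tsum_le_tsum fun z => measure_iUnion_le _
    _ = ∑' z : Site d, ∑' t : Site d, A.indicator (fun z => probOff d p B (eventFNoff A u v t z x)) z := by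
          refine tsum_congr fun z => tsum_congr fun t => ?_
          by_cases hz : z ∈ A
          · simp only [hS, if_pos hz, Set.indicator_of_mem hz, probOff_def]
          · simp only [hS, measure_empty, Set.indicator_apply, if_neg hz]

/-- **(4.63) with the off-`A` clause for the innermost NoBLE kernel** `(u, A, v, x) ↦ P^{B(u)}(E'(v, x; A))`:
`nobleKerXi d p u A v x ≤ Σ_z 𝟙{z ∈ A} Σ_t P^{u}(F_N^{off}((u,v),t,z,x;A))` for `u ≠ v` — the refined input for a
JOINT (two-level) form of (4.65) in which the level-`N` lines `{b̄ ↔ t}, {t ↔ z}` avoid `C̃_{N-1}`.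
[cite: FitznerVanDerHofstad2017, (4.63) with (3.31) and the paragraph after (4.65) (arXiv:1506.07977v2 pp. 42–43, 27)] -/
theorem nobleKerXi_le_tsum_eventFNoff (p : unitInterval) {A : Set (Site d)} {u v x : Site d} (huv : u ≠ v) :
    nobleKerXi d p u A v x ≤
      ∑' z : Site d, ∑' t : Site d, A.indicator (fun z => probOff d p (bondsAt {u}) (eventFNoff A u v t z x)) z :=
  probOff_laceE_le_tsum_eventFNoff p huv

end OffA

end Literature.Probability.FitznerVanDerHofstad2017
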